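import Summits.Langlands.Langlands.Theses.ParityBlindBianchi
import Literature.NumberTheory.Automorphic.BaseChangeInductionAlong
import Literature.NumberTheory.Automorphic.PairLFunctionPolesRepData
import Literature.NumberTheory.Automorphic.KimExteriorSquareGL4Leaves
import Literature.NumberTheory.Automorphic.TwistedAsaiPole
import Literature.NumberTheory.Automorphic.LanglandsTetrahedral
import Literature.NumberTheory.GaloisRepresentations.HeckeCharacter
import Literature.NumberTheory.Automorphic.GLnAdelicStructureProofs

/-!
# Sketch — crux-ideate, crux `ParityBlindBianchi.QuadraticDescentGL2` (stmt-Langlands-16811), ideator 2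

First lemmas of the two idea cards (`gl4-converse-dichotomy`, `theta-dichotomy-go4`), typed over
existing declarations only.  Nothing here is proved; every `def … : Prop` must elaborate.
-/

namespace Summit.Langlands.Langlands.Cruxes.QuadraticDescentGL2.Sketch

open scoped Classical
open Literature.NumberTheory.Automorphic Literature.NumberTheory.GaloisRepresentations
open NumberField IsDedekindDomain

set_option linter.dupNamespace false

/-! ## Card `gl4-converse-dichotomy` -/

/-- **First lemma (type `(4)` exclusion of the pole count).**  For `E/F` quadratic and a cuspidal
`P` on `GL₂(𝔸_E)` with `Gal(E/F)`-stable Satake data, NO cuspidal datum `Q` on `GL₄(𝔸_F)` is a weak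
automorphic induction of `P`: if it were, `L^S_F(s, Q × Q̃) = L^S_E(s, P × P̃) · L^S_E(s, P × P̃^σ)
= L^S_E(s, P × P̃)²` (Satake algebra at split and inert places; `P^σ` has the Satake data of `P`),
a double pole at `s = 1` against Jacquet–Shalika's simple pole for the cuspidal `Q`.
Provable from the named fact `JacquetShalika1981_partialPairL_pole_repData` (at `n = 4` over `F`
and `n = 2` over `E`) with the tree's unitary normalisation and (2.1). -/
def NoCuspidalQuadraticAI : Prop :=
  ∀ (F E : Type) [Field F] [NumberField F] [Field E] [NumberField E] [Algebra F E] [IsGalois F E],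
    Module.finrank F E = 2 →
    ∀ (hE : isCompact_glFiniteIntegralLevel 2 E) (hF : isCompact_glFiniteIntegralLevel 4 F)
      (P : CuspidalAutomorphicRepData 2 E hE) (Q : CuspidalAutomorphicRepData 4 F hF),
      IsGaloisStableSatakeAE F P.1 → ¬ IsAutomorphicInductionAlong P.1 Q.1

/-- The first lemma with its one named-fact hypothesis spelled out (the shape a prover lands
`--supports stmt-Langlands-16811`). -/
def NoCuspidalQuadraticAI_ofJS : Prop :=
  JacquetShalika1981_partialPairL_pole_repData → NoCuspidalQuadraticAI

/-- **Transfer target `C⁺` (the dichotomy the `GL₄` converse theorem delivers).**  For `E/F`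
quadratic and `P` cuspidal on `GL₂(𝔸_E)` with `Gal(E/F)`-stable Satake data: EITHER `P` is already a
weak base change of a cuspidal `π` on `GL₂(𝔸_F)` (Case B: some `L(s, P × BC(τ))` has a pole), OR
the induced Euler product `AI(P)` is weakly automorphic on `GL₄(𝔸_F)` (Case A: every twisted
`L(s, AI(P) × τ) = L(s, P × BC(τ))`, `τ` cuspidal on `GL₁, GL₂ /F`, is nice, and
Cogdell–Piatetski-Shapiro II, Thm. 2 with `T(S; 2) ⊗ ν` makes `AI(P)` quasi-automorphic).  Weaker than
the (trace-formula) named fact `automorphicInduction_cyclic` at `(n, [E:F]) = (2, 2)`, which gives the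
second disjunct outright. -/
def QuadraticAIOrDescent : Prop :=
  ∀ (F E : Type) [Field F] [NumberField F] [Field E] [NumberField E] [Algebra F E] [IsGalois F E],
    Module.finrank F E = 2 →
    ∀ (hF : isCompact_glFiniteIntegralLevel 2 F) (hF4 : isCompact_glFiniteIntegralLevel 4 F)
      (hE : isCompact_glFiniteIntegralLevel 2 E) (P : CuspidalAutomorphicRepData 2 E hE),
      IsGaloisStableSatakeAE F P.1 →
        (∃ π : CuspidalAutomorphicRepData 2 F hF, IsWeakBaseChangeLiftAE π.1 P.1) ∨
          ∃ Q : AutomorphicRepData (AutomorphyDatum.gl 4 F hF4), IsAutomorphicInductionAlong P.1 Q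

/-- **Dihedral structure of quadratic self-twists** (Labesse–Langlands 1979; Arthur–Clozel Ch. 3
Thm. 4.2 (b) at `(n, ℓ) = (2, 2)`; trace-formula-free through Jacquet's lifting dichotomy + Lemma 4.3
pole count): a cuspidal `π` on `GL₂(𝔸_F)` whose Satake data are stable under the sign `ε_{E/F}` is
weakly the automorphic induction of a Hecke character of `E` (a cuspidal datum on `GL₁(𝔸_E)`).
Needed only in the sub-case of the pole count where BOTH `GL₂` constituents of the isobaric support
of `AI(P)` are `η_{E/F}`-stable. -/
def DihedralOfQuadraticSelfTwist : Prop :=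
  ∀ (F E : Type) [Field F] [NumberField F] [Field E] [NumberField E] [Algebra F E] [IsGalois F E],
    Module.finrank F E = 2 →
    ∀ (hF : isCompact_glFiniteIntegralLevel 2 F) (hE1 : isCompact_glFiniteIntegralLevel 1 E)
      (π : CuspidalAutomorphicRepData 2 F hF), IsQuadraticSelfTwistAE E π.1 →
        ∃ θ : CuspidalAutomorphicRepData 1 E hE1, IsAutomorphicInductionAlong θ.1 π.1

/-- **The pole-count half of the line** (`C⁺ → crux`, modulo facts already on the tree + the sibling
crux `QuadraticBaseChangeGL2`): weak automorphic induction of a `Gal`-stable cuspidal `P` to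
`GL₄ /F` forces quadratic descent of `P`.  Isobaric support `Q ∼ ⊞ σ_j |·|^{s_j}` (Langlands 1979,
Prop. 2); `∑ r_j s_j = 0`; types `(4)` [`NoCuspidalQuadraticAI`], `(3,1)/(2,1,1)/(1⁴)` [an extremal
`GL₁` constituent `μ`: `L^S_E(s, P ⊗ μ^{∓1}∘N)` would acquire a pole at a point `Re ≥ 1`], `(2,2)`
[pair `AI(P)` with the non-dihedral extremal `σ_j`: `L^S_E(s, P × BC(σ_j)^{(∨)})` has a pole at
`Re s ≥ 1`, so `BC(σ_j) ≅ P` up to contragredient — DESCENT; both dihedral: contradiction through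
`DihedralOfQuadraticSelfTwist` and isobaric rigidity]. -/
def DescentOfWeakAI : Prop :=
  ∀ (F E : Type) [Field F] [NumberField F] [Field E] [NumberField E] [Algebra F E] [IsGalois F E],
    Module.finrank F E = 2 →
    ∀ (hF : isCompact_glFiniteIntegralLevel 2 F) (hF4 : isCompact_glFiniteIntegralLevel 4 F)
      (hE : isCompact_glFiniteIntegralLevel 2 E) (P : CuspidalAutomorphicRepData 2 E hE),
      IsGaloisStableSatakeAE F P.1 →
        (∃ Q : AutomorphicRepData (AutomorphyDatum.gl 4 F hF4), IsAutomorphicInductionAlong P.1 Q) →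
          ∃ π : CuspidalAutomorphicRepData 2 F hF, IsWeakBaseChangeLiftAE π.1 P.1

/-- **Skeleton preview** (crux-plan shape, not a skeleton): the stubs of the line and how they
compose to the crux BY NAME.  `stub_transfer : QuadraticAIOrDescent` is the one analytic (XL,
trace-formula-free) stub; everything else is Satake algebra + Jacquet–Shalika limits in the tree's
idiom (`IsobaricRigidityRepData`, `ArthurClozelCuspidalDescentIsobaric`). -/
def LineComposition : Prop :=
  Langlands1979_cuspidalSupport_satakeParams →
    JacquetShalika1981_partialPairL_pole_repData →
      JacquetShalika1981_partialPairL_boundary_repData →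
        Theses.ParityBlindBianchi.QuadraticBaseChangeGL2 →
          DihedralOfQuadraticSelfTwist → QuadraticAIOrDescent →
            Theses.ParityBlindBianchi.QuadraticDescentGL2

/-- The pole-count half isolates exactly: -/
def PoleCountReduction : Prop :=
  Langlands1979_cuspidalSupport_satakeParams →
    JacquetShalika1981_partialPairL_pole_repData →
      JacquetShalika1981_partialPairL_boundary_repData →
        Theses.ParityBlindBianchi.QuadraticBaseChangeGL2 →
          DihedralOfQuadraticSelfTwist → DescentOfWeakAI

/-- `C⁺` and the pole count give the crux (pure logic; recorded to fix the shapes). -/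
theorem quadraticDescentGL2_of_dichotomy (hT : QuadraticAIOrDescent) (hD : DescentOfWeakAI) :
    Theses.ParityBlindBianchi.QuadraticDescentGL2 := by
  intro F E _ _ _ _ _ _ h2 hF hE P hP
  have hF4 : isCompact_glFiniteIntegralLevel 4 F := isCompact_glFiniteIntegralLevel_holds 4 F
  unfold QuadraticAIOrDescent at hT
  unfold DescentOfWeakAI at hD
  rcases hT F E h2 hF hF4 hE P hP with ⟨π, hπ⟩ | hQ
  · exact ⟨π, hπ⟩
  · exact hD F E h2 hF hF4 hE P hP hQ

/-! ## Card `theta-dichotomy-go4` -/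

/-- **First lemma (the twisted Asai pole of a `Gal`-stable cuspidal `P` on `GL₂ /E`).**  If the
central character of `P` is (a.e., Satake-wise) the base change `ϑ ∘ N_{E/F}` of a Hecke character
`ϑ` of `F` — which `Gal`-stability forces (Hilbert 90 + Hasse norm theorem for idèle class
characters) — then, twisting by `m_v = ϑ(ϖ_v)⁻¹`, ONE of the two partial Asai `L`-functions
`L^S(s, P, As^± ⊗ ϑ⁻¹)` has a (simple) pole at `s = 1`: their product is `L^S_E(s, P × P̃)`
(Satake identity: at inert `v`, `As⁺ ⊗ m` and `As⁻ ⊗ m = As⁺ ⊗ (-m)` multiply to the `GL₂ × GL₂`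
Euler factor of `P_w × P_w ⊗ (m_v² )`; at split `v` both are `L(P_w × P_{w'} ⊗ m_v)`), which has
Jacquet–Shalika's simple pole, while each factor is meromorphic at `1` with at most a simple pole
(Flicker 1988; Asai transfer `N = 2`).  The sign `κ` that carries the pole selects the character
`ϑ κ`-twist under which `P` is `GL₂(𝔸_F)`-distinguished / theta-lifts to `GL₂(F)`. -/
def TwistedAsaiPoleOfGalStable : Prop :=
  ∀ (F E : Type) [Field F] [NumberField F] [Field E] [NumberField E] [Algebra F E] [IsGalois F E],
    Module.finrank F E = 2 → ∀ (c : E ≃ₐ[F] E), c ≠ 1 →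
    ∀ (hE : isCompact_glFiniteIntegralLevel 2 E) (P : CuspidalAutomorphicRepData 2 E hE)
      (ϑ : HeckeCharacter F),
      IsGaloisStableSatakeAE F P.1 →
      (∀ᶠ w : HeightOneSpectrum (𝓞 E) in Filter.cofinite,
          ∀ (v : HeightOneSpectrum (𝓞 F)) (α : Multiset ℂ), w.asIdeal.under (𝓞 F) = v.asIdeal →
            P.1.HasSatakeParamAt w α →
              α.prod = ϑ.valueAtUniformizer v ^ w.asIdeal.inertiaDeg (𝓞 F)) →
        ∃ κ : ℤˣ, P.1.HasAsaiPoleTwistedBy c ϑ.ramifiedPlaces (fun v => (ϑ.valueAtUniformizer v)⁻¹) κ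

/-- **The theta engine's output, typed** (what the Rallis tower / regularised Siegel–Weil formula is
to deliver from the pole of `TwistedAsaiPoleOfGalStable`): a cuspidal `π` on `GL₂(𝔸_F)` — the
global theta lift of `(P, ϑκ)` extended to `GO(V_E)(𝔸)` — of which `P` is a weak base change.
Stated as the implication "twisted Asai pole ⟹ descent" so that the two halves compose to the crux. -/
def DescentOfTwistedAsaiPole : Prop :=
  ∀ (F E : Type) [Field F] [NumberField F] [Field E] [NumberField E] [Algebra F E] [IsGalois F E],
    Module.finrank F E = 2 → ∀ (c : E ≃ₐ[F] E), c ≠ 1 →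
    ∀ (hF : isCompact_glFiniteIntegralLevel 2 F) (hE : isCompact_glFiniteIntegralLevel 2 E)
      (P : CuspidalAutomorphicRepData 2 E hE) (ϑ : HeckeCharacter F) (κ : ℤˣ),
      IsGaloisStableSatakeAE F P.1 →
        P.1.HasAsaiPoleTwistedBy c ϑ.ramifiedPlaces (fun v => (ϑ.valueAtUniformizer v)⁻¹) κ →
          ∃ π : CuspidalAutomorphicRepData 2 F hF, IsWeakBaseChangeLiftAE π.1 P.1

end Summit.Langlands.Langlands.Cruxes.QuadraticDescentGL2.Sketch
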